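import Summits.QuantumAdvantage.QuantumAdvantage.Theorems.CharDialPartyDialI2

/-!
# PartyDial (decomp-qadv lens-5 g35), part I3 — §8d–e: IsBlindExcept / hybrid_law, selection from fan-in-except-one (hybridFanInLaw), pieces OneDenseFrobOdd / OneDenseFanInFrobOdd PROVED GIVEN LDI3 k, residual TwoDeepFrobOdd k, FrobHardOdd iff TwoDeepFrobOdd k given LDI3 k; degree is necessary (hybrid_needs_degree)

See part A (`CharDialPartyDialA`) for the node header; memo `NODE-g35.md` (g35 folder of decomp-qadv-lens-5).
-/

set_option autoImplicit false
set_option linter.dupNamespace false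

namespace Summit.QuantumAdvantage.QuantumAdvantage.Theorems.PartyDial

open Finset
open Summit.QuantumAdvantage.AdviceFreeQNC0

/-! ### §8d  Blind-except-one strategies, their selection from fan-in, and the pieces after §8 -/

section HybridPieces

variable {n : ℕ}

/-- `k`-BLIND EXCEPT AT `g₀`: `k` disjoint pairs such that every cut OTHER than `g₀` is blind to one of them
and does not split it (`g₀` itself is unrestricted: it may read everything). -/
def IsBlindExcept (g₀ : Fin (n + 1)) (k : ℕ) (y : Fin (n + 1) → (Fin n → Bool) → Bool) : Prop :=
  ∃ lo hi : Fin k → ℕ, (Function.Injective lo ∧ Function.Injective hi ∧ ∀ j j', lo j ≠ hi j') ∧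
    (∀ j, lo j < n ∧ hi j < n) ∧
    ∀ g : Fin (n + 1), g ≠ g₀ → ∃ j : Fin k, (lo j < g.val ↔ hi j < g.val) ∧
      ∀ u v : Fin n → Bool, (∀ i : Fin n, i.val ≠ lo j → i.val ≠ hi j → u i = v i) → y g u = y g v

/-- `k`-blind ⟹ `k`-blind except at any `g₀`. -/
theorem isBlindExcept_of_isBlind {k : ℕ} (g₀ : Fin (n + 1)) {y : Fin (n + 1) → (Fin n → Bool) → Bool}
    (hy : IsBlind k y) : IsBlindExcept g₀ k y := by
  obtain ⟨lo, hi, hP, hlt, hbl⟩ := hy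
  exact ⟨lo, hi, hP, hlt, fun g _ => hbl g⟩

/-- ★★ **THE HYBRID LAW**: a strategy `k`-blind except at one cut `g₀` of `𝔽_p`-degree `≤ D` wins with
probability `≤ 1 − 4^{−(k+1)}`, every charge — GIVEN `LowDegIndep3At p (3^k·D) (1/(12·2^{3^k})) m₀` and
`n ≥ m₀ + 2k`.  The first law of the chain that uses a cut's DEGREE. -/
theorem hybrid_law {k : ℕ} (c : ℕ) (y : Fin (n + 1) → (Fin n → Bool) → Bool) (g₀ : Fin (n + 1))
    (hy : IsBlindExcept g₀ k y) {p : ℕ} [Fact p.Prime] {D m₀ : ℕ} (hdeg : HasDegF p (y g₀) D)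
    (hF : LowDegIndep3At p (3 ^ k * D) (1 / (12 * 2 ^ 3 ^ k)) m₀) (hm : m₀ + 2 * k ≤ n) :
    ((univ.filter fun u : Fin n → Bool => ringWinU c y u = true).card : ℝ) ≤
      (1 - (1 / 4 : ℝ) ^ (k + 1)) * (2 : ℝ) ^ n := by
  obtain ⟨lo, hi, hP, hlt, hbl⟩ := hy
  exact hybrid_law_core hP hlt c y g₀ hbl hdeg hF hm

/-- FAN-IN `ℓ` EXCEPT AT `g₀`: every cut other than `g₀` reads at most `ℓ` bits. -/
def FanInExcept (g₀ : Fin (n + 1)) (ℓ : ℕ) (y : Fin (n + 1) → (Fin n → Bool) → Bool) : Prop :=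
  ∀ g, g ≠ g₀ → ∃ R : Finset (Fin n), R.card ≤ ℓ ∧ ∀ u v : Fin n → Bool, (∀ i ∈ R, u i = v i) → y g u = y g v

/-- **selection**: fan-in `ℓ` except at `g₀` with `(n+1)(ℓ+1)^k < (n/2k)^k` ⟹ `k`-blind except at `g₀`
(silence `g₀` and apply §7b's counting). -/
theorem isBlindExcept_of_fanInExcept {ℓ k : ℕ} {g₀ : Fin (n + 1)} {y : Fin (n + 1) → (Fin n → Bool) → Bool}
    (hy : FanInExcept g₀ ℓ y) (hcnt : (n + 1) * (ℓ + 1) ^ k < (n / (2 * k)) ^ k) : IsBlindExcept g₀ k y := by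
  classical
  set y' : Fin (n + 1) → (Fin n → Bool) → Bool := Function.update y g₀ (fun _ => false) with hy'
  have hfan : FanIn ℓ y' := by
    intro g
    by_cases hg : g = g₀
    · refine ⟨∅, by simp, fun u v _ => ?_⟩
      rw [hy', hg, Function.update_self]
    · obtain ⟨R, hR, hdep⟩ := hy g hg
      refine ⟨R, hR, fun u v huv => ?_⟩
      rw [hy', Function.update_of_ne hg]
      exact hdep u v huv
  obtain ⟨lo, hi, hP, hlt, hbl⟩ := isBlind_of_fanIn hfan hcnt
  refine ⟨lo, hi, hP, hlt, fun g hg => ?_⟩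
  obtain ⟨j, hns, hb⟩ := hbl g
  refine ⟨j, hns, fun u v huv => ?_⟩
  have h := hb u v huv
  rwa [hy', Function.update_of_ne hg] at h

/-- ★★ the hybrid FAN-IN law: all cuts but one of fan-in `ℓ` (`(n+1)(ℓ+1)^k < (n/2k)^k`), the remaining cut
ARBITRARY of `𝔽_p`-degree `≤ D`, GIVEN the fact ⟹ `≤ (1 − 4^{−(k+1)})·2ⁿ`. -/
theorem hybridFanInLaw {ℓ k : ℕ} (hcnt : (n + 1) * (ℓ + 1) ^ k < (n / (2 * k)) ^ k) (c : ℕ)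
    (y : Fin (n + 1) → (Fin n → Bool) → Bool) (g₀ : Fin (n + 1)) (hy : FanInExcept g₀ ℓ y)
    {p : ℕ} [Fact p.Prime] {D m₀ : ℕ} (hdeg : HasDegF p (y g₀) D)
    (hF : LowDegIndep3At p (3 ^ k * D) (1 / (12 * 2 ^ 3 ^ k)) m₀) (hm : m₀ + 2 * k ≤ n) :
    ((univ.filter fun u : Fin n → Bool => ringWinU c y u = true).card : ℝ) ≤
      (1 - (1 / 4 : ℝ) ^ (k + 1)) * (2 : ℝ) ^ n :=
  hybrid_law c y g₀ (isBlindExcept_of_fanInExcept hy hcnt) hdeg hF hm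

/-- **the analytic input of the chain at level `k`** (a conjecture-shaped `Prop`; see `LowDegIndep3At`):
for every prime `p ≥ 5` some `m₀` makes degree-`3^k(p−1)` Booleans `1/(12·2^{3^k})`-independent of dense
forms mod 3.  [In print (exponential sums, Bourgain 2005 / Green–Roy–Straubing 2005 / Chattopadhyay 2006);
NOT in the tree; NOT proved here.] -/
def LDI3 (k : ℕ) : Prop :=
  ∀ (p : ℕ) [Fact p.Prime], 5 ≤ p → ∃ m₀ : ℕ, LowDegIndep3At p (3 ^ k * (p - 1)) (1 / (12 * 2 ^ 3 ^ k)) m₀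

/-- piece (Hₖ), the ONE-DENSE-CUT sector: `FrobHardOdd` restricted to degree-`(p−1)` strategies that are
`k`-blind except at one cut.  [PROVED GIVEN `LDI3 k` with `θ = 1 − 4^{−(k+1)}`: `oneDenseFrobOdd_of_ldi3`;
WEAKER than T; NOT degree-free — with an unrestricted exceptional cut it is FALSE (two cuts, one firing always
and one computing `[addr ≡ 0 (3)]`, win with probability 1).] -/
def OneDenseFrobOdd (k : ℕ) : Prop :=
  ∀ (p : ℕ) [Fact p.Prime], 5 ≤ p → ∃ θ : ℝ, θ < 1 ∧ ∃ n₀ : ℕ, ∀ n ≥ n₀, ∀ c : ℕ,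
    ∀ y : Fin (n + 1) → (Fin n → Bool) → Bool, (∀ g, HasDegF p (y g) (p - 1)) →
      (∃ g₀, IsBlindExcept g₀ k y) →
      ((univ.filter fun u : Fin n → Bool => ringWinU c y u = true).card : ℝ) ≤ θ * (2 : ℝ) ^ n

/-- piece (HLₖ), the ONE-DENSE-CUT FAN-IN sector: all cuts but one of fan-in `ℓ`, `(n+1)(ℓ+1)^k < (n/2k)^k`.
[PROVED GIVEN `LDI3 k`: `oneDenseFanInFrobOdd_of_ldi3`; WEAKER than T] -/
def OneDenseFanInFrobOdd (k : ℕ) : Prop :=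
  ∀ (p : ℕ) [Fact p.Prime], 5 ≤ p → ∃ θ : ℝ, θ < 1 ∧ ∃ n₀ : ℕ, ∀ n ≥ n₀, ∀ c ℓ : ℕ,
    (n + 1) * (ℓ + 1) ^ k < (n / (2 * k)) ^ k →
    ∀ y : Fin (n + 1) → (Fin n → Bool) → Bool, (∀ g, HasDegF p (y g) (p - 1)) →
      (∃ g₀, FanInExcept g₀ ℓ y) →
      ((univ.filter fun u : Fin n → Bool => ringWinU c y u = true).card : ℝ) ≤ θ * (2 : ℝ) ^ n

/-- piece (B⁗ₖ), the TWO-DEEP residual: `FrobHardOdd` restricted to degree-`(p−1)` strategies that are NOT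
`k`-blind except at any single cut — for every cut `g₀` and every `k` disjoint pairs, some OTHER cut depends
on, or splits, each of the pairs («at least two deep cuts»).  [T-implied; UNDECIDED; `⟺ FrobHardOdd` GIVEN
`LDI3 k`: `frobHardOdd_iff_twoDeep`; implied by the §7 residual: `twoDeepFrobOdd_of_deep`] -/
def TwoDeepFrobOdd (k : ℕ) : Prop :=
  ∀ (p : ℕ) [Fact p.Prime], 5 ≤ p → ∃ θ : ℝ, θ < 1 ∧ ∃ n₀ : ℕ, ∀ n ≥ n₀, ∀ c : ℕ,
    ∀ y : Fin (n + 1) → (Fin n → Bool) → Bool, (∀ g, HasDegF p (y g) (p - 1)) →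
      (¬ ∃ g₀, IsBlindExcept g₀ k y) →
      ((univ.filter fun u : Fin n → Bool => ringWinU c y u = true).card : ℝ) ≤ θ * (2 : ℝ) ^ n

/-- `(1/4)^(k+1) > 0`. -/
theorem quarter_pow_succ_pos (k : ℕ) : (0 : ℝ) < (1 / 4 : ℝ) ^ (k + 1) := by positivity

/-- piece (Hₖ) GIVEN the fact. -/
theorem oneDenseFrobOdd_of_ldi3 (k : ℕ) (hF : LDI3 k) : OneDenseFrobOdd k := by
  intro p _ hp
  obtain ⟨m₀, hm₀⟩ := hF p hp
  refine ⟨1 - (1 / 4 : ℝ) ^ (k + 1), by linarith [quarter_pow_succ_pos k], m₀ + 2 * k,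
    fun n hn c y hdeg hy => ?_⟩
  obtain ⟨g₀, hg₀⟩ := hy
  exact hybrid_law c y g₀ hg₀ (hdeg g₀) hm₀ hn

/-- piece (HLₖ) GIVEN the fact. -/
theorem oneDenseFanInFrobOdd_of_ldi3 (k : ℕ) (hF : LDI3 k) : OneDenseFanInFrobOdd k := by
  intro p _ hp
  obtain ⟨m₀, hm₀⟩ := hF p hp
  refine ⟨1 - (1 / 4 : ℝ) ^ (k + 1), by linarith [quarter_pow_succ_pos k], m₀ + 2 * k,
    fun n hn c ℓ hℓ y hdeg hy => ?_⟩
  obtain ⟨g₀, hg₀⟩ := hy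
  exact hybridFanInLaw hℓ c y g₀ hg₀ (hdeg g₀) hm₀ hn

/-- T ⟹ (B⁗ₖ) (projection). -/
theorem twoDeepFrobOdd_of_frobHardOdd (k : ℕ)
    (hT : Summit.QuantumAdvantage.QuantumAdvantage.Theses.CharDial.FrobHardOdd) : TwoDeepFrobOdd k := by
  intro p _ hp
  obtain ⟨θ, hθ, n₀, h⟩ := hT p hp
  exact ⟨θ, hθ, n₀, fun n hn c y hy _ => h n hn c y hy⟩

/-- (B‴ₖ) ⟹ (B⁗ₖ): the §7 residual implies the §8 residual (`¬ blind-except ⊆ ¬ blind`). -/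
theorem twoDeepFrobOdd_of_deep (k : ℕ) (hB : DeepFrobOdd k) : TwoDeepFrobOdd k := by
  intro p _ hp
  obtain ⟨θ, hθ, n₀, h⟩ := hB p hp
  refine ⟨θ, hθ, n₀, fun n hn c y hy hS => h n hn c y hy fun hS' => hS ?_⟩
  exact ⟨0, isBlindExcept_of_isBlind 0 hS'⟩

/-- ★★★ item 32598 from the fact and the TWO-DEEP residual, every `k`. -/
theorem frobHardOdd_of_twoDeep (k : ℕ) (hF : LDI3 k) (hB : TwoDeepFrobOdd k) :
    Summit.QuantumAdvantage.QuantumAdvantage.Theses.CharDial.FrobHardOdd := by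
  intro p _ hp
  obtain ⟨θ₁, hθ₁, n₁, h₁⟩ := oneDenseFrobOdd_of_ldi3 k hF p hp
  obtain ⟨θ₂, hθ₂, n₂, h₂⟩ := hB p hp
  refine ⟨max θ₁ θ₂, max_lt hθ₁ hθ₂, max n₁ n₂, fun n hn c y hy => ?_⟩
  have h2 : (0 : ℝ) ≤ (2 : ℝ) ^ n := by positivity
  by_cases hS : ∃ g₀, IsBlindExcept g₀ k y
  · exact (h₁ n (le_of_max_le_left hn) c y hy hS).trans (mul_le_mul_of_nonneg_right (le_max_left _ _) h2)
  · exact (h₂ n (le_of_max_le_right hn) c y hy hS).trans (mul_le_mul_of_nonneg_right (le_max_right _ _) h2)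

/-- **The dial on T after §8**: GIVEN the analytic fact `LDI3 k`, `FrobHardOdd ⟺ TwoDeepFrobOdd k` (the
one-dense-cut sector is decided). -/
theorem frobHardOdd_iff_twoDeep (k : ℕ) (hF : LDI3 k) :
    Summit.QuantumAdvantage.QuantumAdvantage.Theses.CharDial.FrobHardOdd ↔ TwoDeepFrobOdd k :=
  ⟨twoDeepFrobOdd_of_frobHardOdd k, frobHardOdd_of_twoDeep k hF⟩

end HybridPieces

/-! ### §8e  Degree is NECESSARY in the hybrid law: with an unrestricted exceptional cut, two cuts win surely -/

section HybridNecessity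

variable {n : ℕ}

/-- **the degree hypothesis of §8 is load-bearing**: for every `n ≥ 4` and every charge there is a strategy,
`2`-blind except at ONE cut, that wins on EVERY input — cut `0` fires always, cut `1` fires exactly when cut `0`'s
address is `≡ 0 (mod 3)` (a `MOD₃` function: `𝔽_p`-degree `Ω(n)`, excluded by `HasDegF p · (p−1)`), all other
cuts silent; exactly one ring fires.  So `OneDenseFrobOdd k` with the degree hypothesis dropped is FALSE, and the
analytic hypothesis `LowDegIndep3At` in `hybrid_law` cannot be removed. -/
theorem hybrid_needs_degree (hn : 4 ≤ n) (c : ℕ) :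
    ∃ (g₀ : Fin (n + 1)) (y : Fin (n + 1) → (Fin n → Bool) → Bool),
      IsBlindExcept g₀ 2 y ∧ ∀ u : Fin n → Bool, ringWinU c y u = true := by
  classical
  set y : Fin (n + 1) → (Fin n → Bool) → Bool := fun g u =>
    if g.val = 0 then true else if g.val = 1 then decide ((c + wt u) % 3 = 0) else false with hy
  refine ⟨⟨1, by omega⟩, y, ⟨![0, 2], ![1, 3], ⟨?_, ?_, ?_⟩, ?_, ?_⟩, ?_⟩
  · intro a b h; fin_cases a <;> fin_cases b <;> simp_all
  · intro a b h; fin_cases a <;> fin_cases b <;> simp_all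
  · intro j j'; fin_cases j <;> fin_cases j' <;> simp
  · intro j; fin_cases j <;> simp <;> omega
  · intro g hg
    have hg1 : g.val ≠ 1 := fun h => hg (Fin.ext h)
    refine ⟨0, ?_, fun u v _ => ?_⟩
    · show (![0, 2] : Fin 2 → ℕ) 0 < g.val ↔ (![1, 3] : Fin 2 → ℕ) 0 < g.val
      simp only [Matrix.cons_val_zero]
      omega
    · simp only [hy, hg1, if_false]
  · intro u
    -- cut 0's exponent is `wt u`; cut 1's is `wt u + [u 0]`
    have hw0 : walkExp u 0 = wt u := by
      unfold walkExp wtPrefix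
      simp
    have hw1 : wt u ≤ walkExp u 1 ∧ walkExp u 1 ≤ wt u + 1 := by
      unfold walkExp wtPrefix
      constructor
      · omega
      · have : (univ.filter fun i : Fin n => i.val < 1 ∧ u i = true).card ≤ 1 := by
          refine (Finset.card_le_card (t := {⟨0, by omega⟩}) fun i hi => ?_).trans (by simp)
          rw [mem_filter] at hi
          rw [Finset.mem_singleton, Fin.ext_iff]
          simp only
          omega
        omega
    unfold ringWinU
    rw [decide_eq_true_iff]
    suffices h : (univ.filter fun g : Fin (n + 1) => y g u = true ∧ (c + g.val + walkExp u g.val) % 3 ≠ 0).card = 1 by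
      rw [h]
    rw [Finset.card_eq_one]
    by_cases h0 : (c + wt u) % 3 = 0
    · refine ⟨⟨1, by omega⟩, Finset.ext fun g => ?_⟩
      rw [mem_filter, Finset.mem_singleton, Fin.ext_iff]
      simp only [mem_univ, true_and, hy]
      constructor
      · rintro ⟨hfire, hne⟩
        by_contra hg1
        by_cases hg0 : g.val = 0
        · rw [hg0, hw0] at hne
          exact hne (by simpa using h0)
        · simp [hg0, hg1] at hfire
      · intro hg1
        rw [hg1]
        refine ⟨by simp [h0], ?_⟩
        omega
    · refine ⟨⟨0, by omega⟩, Finset.ext fun g => ?_⟩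
      rw [mem_filter, Finset.mem_singleton, Fin.ext_iff]
      simp only [mem_univ, true_and, hy]
      constructor
      · rintro ⟨hfire, hne⟩
        by_contra hg0
        by_cases hg1 : g.val = 1
        · simp [hg1, h0] at hfire
        · simp [hg0, hg1] at hfire
      · intro hg0
        rw [hg0]
        refine ⟨by simp, ?_⟩
        rw [hw0]
        simpa using h0

end HybridNecessity

end Summit.QuantumAdvantage.QuantumAdvantage.Theorems.PartyDial
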